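import Mathlib.Algebra.BigOperators.Intervals
import Mathlib.Algebra.BigOperators.Ring.Finset
import Mathlib.Algebra.Order.BigOperators.Group.LocallyFinite
import Mathlib.Tactic.Ring
import Mathlib.Tactic.LinearCombination
import HarnessLib

/-!
# Volkov PRD 109, 036012 (2024) §IV «Equivalence to on-shell renormalization»: the two printed ALGEBRAIC steps — (i) §IV B's worked 3-loop class (arXiv TABLE I, ten rows of U-operator terms) summed and CANCELLED under the four printed per-graph Ward corollaries; (ii) §IV C step 7's displayed A-node placement identity «(U₁′,…,U₁′) + (L′−U₁′,U₁′,…,U₁′) + (L′,L′−U₁′,U₁′,…,U₁′) + … + (L′,…,L′,L′−U₁′) = (L′,…,L′)», PROVED for every length as a telescoping sum — with ONE print-check datum on the «After summation» display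

independent recomputation; certified where stated, statistical where stated; no new-physics claim.

CITATION HEADER (venture `QEDPrecision`, cell `pub-qed`, track TROPICAL seat V3b = `pub-qed-trop-v3-lit-2` gen 34; VALUE-FREE: polynomial
identities between the printed operator-value SYMBOLS only — no integral, no graph of the cell, nothing per word). Serves
`tropical/view/V3-VOLKOV-DEGREES.md` §B B.4 (what the «justification» paper justifies) and the cell's `irse/lit/VOLKOV-IR-EXTRACT-lit.md` §3.7
(«V23 §IV … the combinatorial equivalence proof IS printed in full … locators for the typist only»): the subtraction side of the 2020–2024
texts, complementary to `ForestFormulaCases` (the forest-formula case tables) in this directory.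

Source. [Volkov2024PRD109] S. Volkov, "Calculation of lepton magnetic moments in quantum electrodynamics: a justification of the flexible
divergence elimination method", Phys. Rev. D 109, 036012 (2024) = arXiv:2308.11560v4 (pages below = arXiv v4 pages; e-print tex
`method_details_2023.tex` held by the cell under `data/lit/sources/.cache/2308.11560/`; journal pagination not held), VERBATIM:
* §IV B (p.11–12; tex l.502): "Table I provides the parts of the contributions, obtained with our method, that contain U-operators. … By Γ₁
  and Σ₁ we also denote the 1-loop vertexlike and lepton self-energy amplitudes (without special vertices), respectively."
  TABLE I "Contributions with U-operators of the graphs from Fig. 5 obtained with our method" (p.12; tex l.504–523), rows 1–10: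
  1: −(A′Γ₁)(U₁′Γ_λ) − (A′Γ_λ)(U₁′Γ₁) + (A′Γ₁)(U₁′Γ₁)² ·
  2: −(A′Γ_ρ)(U₁′Γ₁) − (A′Γ_λ)(U₁′Σ₁) + (A′Γ₁)(U₁′Γ₁)(U₁′Σ₁) + (A′Γ_M)(U₁′Γ₁)(M′Σ₁) ·
  3: −(A′Γ₁)(U₁′Γ_×) ·
  4: −(A′Γ₁)(U₁′Γ_λ) − (A′Γ_λ)(U₁′Γ₁) + (A′Γ₁)(U₁′Γ₁)² ·
  5: −(A′Γ₁)(U₁′Γ_ρ) − (A′Γ_λ)(U₁′Σ₁) + (A′Γ₁)(U₁′Γ₁)(U₁′Σ₁) + (A′Γ₁)(U₁′Γ_M)(M′Σ₁) ·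
  6: −(A′Γ₁)(U₁′Γ_≈) − (A′Γ_λ)(U₁′Γ₁) + (A′Γ₁)(U₁′Γ₁)² ·
  7: −(A′Γ₁)(U₁′Γ_ρ) − (A′Γ_λ)(U₁′Σ₁) + (A′Γ₁)(U₁′Γ₁)(U₁′Σ₁) + (A′Γ₁)(U₁′Γ_M)(M′Σ₁) ·
  8: −2(A′Γ_ρ)(U₁′Σ₁) + (A′Γ₁)(U₁′Σ₁)² + 2(A′Γ_M)(U₁′Σ₁)(M′Σ₁) ·
  9: −(A′Γ₁)(U₁′Σ_×) − 2(A′Γ_ρ)(U₁′Γ₁) + 2(A′Γ₁)(U₁′Σ₁)(U₁′Γ₁) + 2(A′Γ_M)(M′Σ₁)(U₁′Γ₁) ·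
  10: −(A′Γ₁)(U₁′Σ_≈) − (A′Γ_ρ)(U₁′Σ₁) + (A′Γ₁)(U₁′Σ₁)² + (A′Γ_M)(M′Σ₁)(U₁′Σ₁) + (A′Γ₁)(U₁′Σ_M)(M′Σ₁).
  Then (p.12; tex l.531–537): "After summation, we obtain
  (A′Γ₁)(−[2U₁′Γ_λ + U₁′Γ_× + U₁′Σ_×] − [2U₁′Γ_ρ + U₁′Γ_≈ + U₁′Σ_≈]) + [U₁′Γ₁+U₁′Σ₁](−3A′Γ_λ − 3A′Γ_ρ + (A′Γ₁)(3U₁′Γ₁ + 2U₁′Σ₁))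
  + (A′Γ₁)(M′Σ₁)[2U₁′Γ_M+U₁′Σ_M]"; (tex l.538–548) "We use the following Ward identities for individual graphs: … The corollary is
  U₁′Γ₁+U₁′Σ₁ = 0, 2U₁′Γ_M+U₁′Σ_M = 0, 2U₁′Γ_λ+U₁′Γ_×+U₁′Σ_× = 0, 2U₁′Γ_ρ+U₁′Γ_≈+U₁′Σ_≈ = 0."; (tex l.549) "From this it follows
  that all terms with U₁′ are cancelled."
* §IV C step 7 (p.18–19; tex l.699–743): "Combine the terms with different placements of the A-nodes. After the previous step, the contribution
  can be written as a sum of terms like (16) (−1)^{n−1}(O₁′Γ₁)(O₂′Γ₂)…(O_n′Γ_n) … Thus, the sum can be represented as a sum of terms (16) with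
  the same conditions, but with vectors (O₁′,…,O_n′) of the form (A′,U₁′,…,U₁′) or (A′,L′,…,L′,L′−U₁′,U₁′,…,U₁′). We can prove by induction that
  (U₁′,U₁′,U₁′,…,U₁′,U₁′) + (L−U₁′,U₁′,U₁′,…,U₁′,U₁′) + (L′,L′−U₁′,U₁′,…,U₁′,U₁′) + … + (L′,L′,L′,…,L′,L′−U₁′) = (L′,L′,L′,…,L′,L′).
  Thus, we arrive at the sum of terms (17) (−1)^{n−1}(A′Γ₁)(L′Γ₂)…(L′Γ_n) with the same conditions." (The second summand prints «L» for
  «L′»; read L′.)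

The model. The operator values O′Γ are commuting scalars of a commutative ring R ("The contribution of the layer tree (without coefficient) is
the product of the node values", §IV C, tex l.612): (i) the fifteen symbols of TABLE I are the fields of `Set3Values R`; the ten rows, their sum
and the printed «After summation» expression are polynomials in them; the four Ward corollaries enter as HYPOTHESES of the cancellation
theorem (they are consequences of Ward identities for amplitudes — analysis, not typed here). (ii) A vector (O₁′,…,O_n′) stands for the
product ∏ᵢ OᵢΓᵢ (display (16)); with uᵢ := U₁′Γᵢ and lᵢ := L′Γᵢ the k-th summand of the displayed identity, (L′,…,L′,L′−U₁′,U₁′,…,U₁′) with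
L′−U₁′ in slot k, is (∏_{i<k} lᵢ)(l_k − u_k)(∏_{i>k} uᵢ) — slots indexed 0 … n−1 below.

What the kernel certifies:
* `Set3Values.tableSum_eq` (`ring`) — THE PRINT-CHECK DATUM: the sum of the ten printed rows equals the printed «After summation» expression
  PLUS 3·(A′Γ_M)(M′Σ₁)·[U₁′Γ₁ + U₁′Σ₁] — the display omits the three (A′Γ_M)(M′Σ₁)-terms of rows 2, 8, 9, 10 (total (A′Γ_M)(M′Σ₁)(3U₁′Γ₁ +
  3U₁′Σ₁)); the omitted part is itself a multiple of the first Ward corollary, so the printed CONCLUSION is unaffected (next item). Checked on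
  the arXiv v4 PDF text (p.12) = the e-print tex; the journal page is not held by the cell.
* `Set3Values.tableSum_eq_zero_of_ward`, `Set3Values.afterSummation_eq_zero_of_ward` (`linear_combination`) — "From this it follows that all
  terms with U₁′ are cancelled": under the four printed corollaries BOTH the true row sum and the printed display vanish identically.
* `aNode_telescope` — §IV C step 7's displayed identity for EVERY n ≥ 0 over any commutative ring:
  ∏_{i<n} uᵢ + Σ_{k<n} (∏_{i<k} lᵢ)(l_k − u_k)(∏_{k<i<n} uᵢ) = ∏_{i<n} lᵢ ("We can prove by induction" — here: the k-th summand is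
  P(k+1) − P(k) with P(k) := (∏_{i<k} lᵢ)(∏_{k≤i<n} uᵢ), `aNode_summand_eq_sub`, and the sum telescopes, `Finset.sum_range_sub`);
  `aNode_telescope_three` — the n = 3 instance literally as displayed (`ring`); `eqTermAfter_sum_eq_eqTermFinal` — with the A-node in front,
  (A′,U₁′,…,U₁′) + Σ_k (A′,L′,…,L′,L′−U₁′,U₁′,…,U₁′) = (A′,L′,…,L′), i.e. display (16)'s family sums to display (17)'s term.
NOT CLAIMED (print only): the Ward identities themselves and their corollaries (QED analysis, "standard methods … See [Peskin–Schroeder]");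
steps 1–6 of §IV C (layer trees, M-blocks, the equivalence classes and their factorisations); the class-IV(b)/IV(c) displays of §IV B (printed
as figures); that TABLE I is the U-part of the method's expression for the ten graphs of Fig. 5 (forest-formula bookkeeping — cf.
`ForestFormulaCases` for the typed case tables); anything about convergence or about any integral.
-/

open Finset

namespace Literature.MathematicalPhysics.QuantumFieldTheory.Volkov2024PRD109

/-! ## §IV B — TABLE I of the 3-loop gauge-invariant class (arXiv FIG. 5) and its summation -/

/-- The fifteen operator values appearing in TABLE I and in the «After summation» display, as commuting scalars: A′ applied to
Γ₁, Γ_λ, Γ_ρ, Γ_M; U₁′ applied to Γ₁, Γ_λ, Γ_ρ, Γ_×, Γ_≈, Γ_M and to Σ₁, Σ_×, Σ_≈, Σ_M; M′ applied to Σ₁ (the amplitudes of arXiv FIG. 6).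
[cite: Volkov2024PRD109, §IV B TABLE I (arXiv v4 p.12; tex l.504–523)] -/
structure Set3Values (R : Type*) where
  /-- A′Γ₁ -/
  aG1 : R
  /-- A′Γ_λ -/
  aGl : R
  /-- A′Γ_ρ -/
  aGr : R
  /-- A′Γ_M -/
  aGM : R
  /-- U₁′Γ₁ -/
  uG1 : R
  /-- U₁′Γ_λ -/
  uGl : R
  /-- U₁′Γ_ρ -/
  uGr : R
  /-- U₁′Γ_× -/
  uGx : R
  /-- U₁′Γ_≈ -/
  uGa : R
  /-- U₁′Γ_M -/
  uGM : R
  /-- U₁′Σ₁ -/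
  uS1 : R
  /-- U₁′Σ_× -/
  uSx : R
  /-- U₁′Σ_≈ -/
  uSa : R
  /-- U₁′Σ_M -/
  uSM : R
  /-- M′Σ₁ -/
  mS1 : R

namespace Set3Values

variable {R : Type*} [CommRing R] (v : Set3Values R)

/-- TABLE I row 1 (graph 1): −(A′Γ₁)(U₁′Γ_λ) − (A′Γ_λ)(U₁′Γ₁) + (A′Γ₁)(U₁′Γ₁)². [cite: Volkov2024PRD109, §IV B TABLE I row 1 (arXiv v4 p.12)] -/
def row1 : R := -(v.aG1 * v.uGl) - v.aGl * v.uG1 + v.aG1 * v.uG1 ^ 2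

/-- TABLE I row 2: −(A′Γ_ρ)(U₁′Γ₁) − (A′Γ_λ)(U₁′Σ₁) + (A′Γ₁)(U₁′Γ₁)(U₁′Σ₁) + (A′Γ_M)(U₁′Γ₁)(M′Σ₁).
[cite: Volkov2024PRD109, §IV B TABLE I row 2 (arXiv v4 p.12)] -/
def row2 : R := -(v.aGr * v.uG1) - v.aGl * v.uS1 + v.aG1 * v.uG1 * v.uS1 + v.aGM * v.uG1 * v.mS1

/-- TABLE I row 3: −(A′Γ₁)(U₁′Γ_×). [cite: Volkov2024PRD109, §IV B TABLE I row 3 (arXiv v4 p.12)] -/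
def row3 : R := -(v.aG1 * v.uGx)

/-- TABLE I row 4: −(A′Γ₁)(U₁′Γ_λ) − (A′Γ_λ)(U₁′Γ₁) + (A′Γ₁)(U₁′Γ₁)² (same expression as row 1).
[cite: Volkov2024PRD109, §IV B TABLE I row 4 (arXiv v4 p.12)] -/
def row4 : R := -(v.aG1 * v.uGl) - v.aGl * v.uG1 + v.aG1 * v.uG1 ^ 2

/-- TABLE I row 5: −(A′Γ₁)(U₁′Γ_ρ) − (A′Γ_λ)(U₁′Σ₁) + (A′Γ₁)(U₁′Γ₁)(U₁′Σ₁) + (A′Γ₁)(U₁′Γ_M)(M′Σ₁).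
[cite: Volkov2024PRD109, §IV B TABLE I row 5 (arXiv v4 p.12)] -/
def row5 : R := -(v.aG1 * v.uGr) - v.aGl * v.uS1 + v.aG1 * v.uG1 * v.uS1 + v.aG1 * v.uGM * v.mS1

/-- TABLE I row 6: −(A′Γ₁)(U₁′Γ_≈) − (A′Γ_λ)(U₁′Γ₁) + (A′Γ₁)(U₁′Γ₁)². [cite: Volkov2024PRD109, §IV B TABLE I row 6 (arXiv v4 p.12)] -/
def row6 : R := -(v.aG1 * v.uGa) - v.aGl * v.uG1 + v.aG1 * v.uG1 ^ 2

/-- TABLE I row 7: −(A′Γ₁)(U₁′Γ_ρ) − (A′Γ_λ)(U₁′Σ₁) + (A′Γ₁)(U₁′Γ₁)(U₁′Σ₁) + (A′Γ₁)(U₁′Γ_M)(M′Σ₁) (same expression as row 5).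
[cite: Volkov2024PRD109, §IV B TABLE I row 7 (arXiv v4 p.12)] -/
def row7 : R := -(v.aG1 * v.uGr) - v.aGl * v.uS1 + v.aG1 * v.uG1 * v.uS1 + v.aG1 * v.uGM * v.mS1

/-- TABLE I row 8: −2(A′Γ_ρ)(U₁′Σ₁) + (A′Γ₁)(U₁′Σ₁)² + 2(A′Γ_M)(U₁′Σ₁)(M′Σ₁). [cite: Volkov2024PRD109, §IV B TABLE I row 8 (arXiv v4 p.12)] -/
def row8 : R := -(2 * (v.aGr * v.uS1)) + v.aG1 * v.uS1 ^ 2 + 2 * (v.aGM * v.uS1 * v.mS1)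

/-- TABLE I row 9: −(A′Γ₁)(U₁′Σ_×) − 2(A′Γ_ρ)(U₁′Γ₁) + 2(A′Γ₁)(U₁′Σ₁)(U₁′Γ₁) + 2(A′Γ_M)(M′Σ₁)(U₁′Γ₁).
[cite: Volkov2024PRD109, §IV B TABLE I row 9 (arXiv v4 p.12)] -/
def row9 : R := -(v.aG1 * v.uSx) - 2 * (v.aGr * v.uG1) + 2 * (v.aG1 * v.uS1 * v.uG1) + 2 * (v.aGM * v.mS1 * v.uG1)

/-- TABLE I row 10: −(A′Γ₁)(U₁′Σ_≈) − (A′Γ_ρ)(U₁′Σ₁) + (A′Γ₁)(U₁′Σ₁)² + (A′Γ_M)(M′Σ₁)(U₁′Σ₁) + (A′Γ₁)(U₁′Σ_M)(M′Σ₁).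
[cite: Volkov2024PRD109, §IV B TABLE I row 10 (arXiv v4 p.12)] -/
def row10 : R :=
  -(v.aG1 * v.uSa) - v.aGr * v.uS1 + v.aG1 * v.uS1 ^ 2 + v.aGM * v.mS1 * v.uS1 + v.aG1 * v.uSM * v.mS1

/-- The sum of the ten rows of TABLE I ("After summation, we obtain …" — its left-hand side).
[cite: Volkov2024PRD109, §IV B (arXiv v4 p.12; tex l.531)] -/
def tableSum : R :=
  v.row1 + v.row2 + v.row3 + v.row4 + v.row5 + v.row6 + v.row7 + v.row8 + v.row9 + v.row10

/-- The printed «After summation» expression, verbatim: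
(A′Γ₁)(−[2U₁′Γ_λ + U₁′Γ_× + U₁′Σ_×] − [2U₁′Γ_ρ + U₁′Γ_≈ + U₁′Σ_≈]) + [U₁′Γ₁+U₁′Σ₁](−3A′Γ_λ − 3A′Γ_ρ + (A′Γ₁)(3U₁′Γ₁ + 2U₁′Σ₁))
+ (A′Γ₁)(M′Σ₁)[2U₁′Γ_M+U₁′Σ_M]. [cite: Volkov2024PRD109, §IV B (arXiv v4 p.12; tex l.532–537)] -/
def afterSummation : R :=
  v.aG1 * (-(2 * v.uGl + v.uGx + v.uSx) - (2 * v.uGr + v.uGa + v.uSa))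
    + (v.uG1 + v.uS1) * (-(3 * v.aGl) - 3 * v.aGr + v.aG1 * (3 * v.uG1 + 2 * v.uS1))
    + v.aG1 * v.mS1 * (2 * v.uGM + v.uSM)

/-- PRINT-CHECK DATUM. The ten printed rows sum to the printed «After summation» expression PLUS 3(A′Γ_M)(M′Σ₁)[U₁′Γ₁ + U₁′Σ₁]: the display
omits the (A′Γ_M)(M′Σ₁)-terms of rows 2, 9 (with U₁′Γ₁: 1 + 2) and 8, 10 (with U₁′Σ₁: 2 + 1); every other monomial agrees. The omitted
part is a multiple of the first Ward corollary, so the printed conclusion stands (`tableSum_eq_zero_of_ward`).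
[cite: Volkov2024PRD109, §IV B TABLE I + «After summation» (arXiv v4 p.12; tex l.504–537)] -/
theorem tableSum_eq : v.tableSum = v.afterSummation + 3 * (v.aGM * v.mS1) * (v.uG1 + v.uS1) := by
  simp only [tableSum, row1, row2, row3, row4, row5, row6, row7, row8, row9, row10, afterSummation]
  ring

/-- The rows with no (A′Γ_M)(M′Σ₁)-term are reproduced exactly: restricted to A′Γ_M = 0 (or M′Σ₁ = 0) the printed display IS the row sum.
[cite: Volkov2024PRD109, §IV B (arXiv v4 p.12)] -/
theorem tableSum_eq_afterSummation_of_aGM_eq_zero (h : v.aGM = 0) : v.tableSum = v.afterSummation := by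
  rw [tableSum_eq, h]; ring

/-- "The corollary is U₁′Γ₁+U₁′Σ₁ = 0, 2U₁′Γ_M+U₁′Σ_M = 0, 2U₁′Γ_λ+U₁′Γ_×+U₁′Σ_× = 0, 2U₁′Γ_ρ+U₁′Γ_≈+U₁′Σ_≈ = 0. From this it follows that
all terms with U₁′ are cancelled." — the sum of the ten rows of TABLE I vanishes under the four printed corollaries (hypotheses here).
[cite: Volkov2024PRD109, §IV B (arXiv v4 p.12; tex l.545–549)] -/
theorem tableSum_eq_zero_of_ward (h₁ : v.uG1 + v.uS1 = 0) (h₂ : 2 * v.uGM + v.uSM = 0)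
    (h₃ : 2 * v.uGl + v.uGx + v.uSx = 0) (h₄ : 2 * v.uGr + v.uGa + v.uSa = 0) : v.tableSum = 0 := by
  rw [tableSum_eq]
  simp only [afterSummation]
  linear_combination (-(3 * v.aGl) - 3 * v.aGr + v.aG1 * (3 * v.uG1 + 2 * v.uS1) + 3 * (v.aGM * v.mS1)) * h₁
    + v.aG1 * v.mS1 * h₂ - v.aG1 * h₃ - v.aG1 * h₄

/-- The printed display vanishes under the same four corollaries (so the omission in `tableSum_eq` does not touch the conclusion).
[cite: Volkov2024PRD109, §IV B (arXiv v4 p.12; tex l.532–549)] -/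
theorem afterSummation_eq_zero_of_ward (h₁ : v.uG1 + v.uS1 = 0) (h₂ : 2 * v.uGM + v.uSM = 0)
    (h₃ : 2 * v.uGl + v.uGx + v.uSx = 0) (h₄ : 2 * v.uGr + v.uGa + v.uSa = 0) : v.afterSummation = 0 := by
  simp only [afterSummation]
  linear_combination (-(3 * v.aGl) - 3 * v.aGr + v.aG1 * (3 * v.uG1 + 2 * v.uS1)) * h₁
    + v.aG1 * v.mS1 * h₂ - v.aG1 * h₃ - v.aG1 * h₄

/-- Rows 1 = 4 and 5 = 7 are printed as identical expressions (the mirror-image graphs of FIG. 5).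
[cite: Volkov2024PRD109, §IV B TABLE I (arXiv v4 p.12)] -/
theorem row1_eq_row4_and_row5_eq_row7 : v.row1 = v.row4 ∧ v.row5 = v.row7 := ⟨rfl, rfl⟩

end Set3Values

/-! ## §IV C step 7 — the A-node placement identity, for every length -/

section ANode

variable {R : Type*} [CommRing R]

/-- P(k) := (∏_{i<k} lᵢ)(∏_{k≤i<n} uᵢ) — the value of the vector (L′,…,L′,U₁′,…,U₁′) with k entries L′ (display (16)'s product
semantics (O₁′,…,O_n′) ↦ ∏ᵢ OᵢΓᵢ, with uᵢ = U₁′Γᵢ, lᵢ = L′Γᵢ). [cite: Volkov2024PRD109, §IV C step 7, display (16) (arXiv v4 p.18–19; tex l.700–705)] -/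
def aNodePrefix (u l : ℕ → R) (n k : ℕ) : R := (∏ i ∈ range k, l i) * ∏ i ∈ Ico k n, u i

/-- P(0) = (U₁′,…,U₁′) = ∏_{i<n} uᵢ. [cite: Volkov2024PRD109, §IV C step 7 (arXiv v4 p.19; tex l.718–720)] -/
theorem aNodePrefix_zero (u l : ℕ → R) (n : ℕ) : aNodePrefix u l n 0 = ∏ i ∈ range n, u i := by
  simp [aNodePrefix, Nat.Ico_zero_eq_range]

/-- P(n) = (L′,…,L′) = ∏_{i<n} lᵢ. [cite: Volkov2024PRD109, §IV C step 7 (arXiv v4 p.19; tex l.733–735)] -/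
theorem aNodePrefix_self (u l : ℕ → R) (n : ℕ) : aNodePrefix u l n n = ∏ i ∈ range n, l i := by
  simp [aNodePrefix]

/-- The induction step behind "We can prove by induction": the summand with L′−U₁′ in slot k, (L′,…,L′,L′−U₁′,U₁′,…,U₁′) =
(∏_{i<k} lᵢ)(l_k − u_k)(∏_{k<i<n} uᵢ), is the difference P(k+1) − P(k) of two consecutive pure vectors.
[cite: Volkov2024PRD109, §IV C step 7 (arXiv v4 p.19; tex l.717–736)] -/
theorem aNode_summand_eq_sub (u l : ℕ → R) {n k : ℕ} (hk : k < n) :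
    (∏ i ∈ range k, l i) * (l k - u k) * (∏ i ∈ Ico (k + 1) n, u i) =
      aNodePrefix u l n (k + 1) - aNodePrefix u l n k := by
  simp only [aNodePrefix]
  rw [Finset.prod_range_succ, Finset.prod_eq_prod_Ico_succ_bot hk]
  ring

/-- §IV C step 7, the displayed identity, for EVERY n over any commutative ring:
«(U₁′,U₁′,…,U₁′) + (L′−U₁′,U₁′,…,U₁′) + (L′,L′−U₁′,U₁′,…,U₁′) + … + (L′,…,L′,L′−U₁′) = (L′,L′,…,L′)», i.e.
∏_{i<n} uᵢ + Σ_{k<n} (∏_{i<k} lᵢ)(l_k − u_k)(∏_{k<i<n} uᵢ) = ∏_{i<n} lᵢ — the sum telescopes through the P(k).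
[cite: Volkov2024PRD109, §IV C step 7 (arXiv v4 p.19; tex l.717–736)] -/
theorem aNode_telescope (u l : ℕ → R) (n : ℕ) :
    (∏ i ∈ range n, u i) + ∑ k ∈ range n, (∏ i ∈ range k, l i) * (l k - u k) * (∏ i ∈ Ico (k + 1) n, u i) =
      ∏ i ∈ range n, l i := by
  have hsum : ∑ k ∈ range n, (∏ i ∈ range k, l i) * (l k - u k) * (∏ i ∈ Ico (k + 1) n, u i) =
      ∑ k ∈ range n, (aNodePrefix u l n (k + 1) - aNodePrefix u l n k) := by
    refine Finset.sum_congr rfl fun k hk => ?_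
    exact aNode_summand_eq_sub u l (Finset.mem_range.mp hk)
  rw [hsum, Finset.sum_range_sub, aNodePrefix_zero, aNodePrefix_self]
  ring

/-- The n = 3 instance exactly as the display reads with three slots: (U,U,U) + (L−U,U,U) + (L,L−U,U) + (L,L,L−U) = (L,L,L).
[cite: Volkov2024PRD109, §IV C step 7 (arXiv v4 p.19; tex l.717–736)] -/
theorem aNode_telescope_three (u₁ u₂ u₃ l₁ l₂ l₃ : R) :
    u₁ * u₂ * u₃ + (l₁ - u₁) * u₂ * u₃ + l₁ * (l₂ - u₂) * u₃ + l₁ * l₂ * (l₃ - u₃) = l₁ * l₂ * l₃ := by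
  ring

/-- From display (16) to display (17): with the A-node value a = A′Γ₁ in front and the identity applied to the remaining slots,
(A′,U₁′,…,U₁′) + Σ_k (A′,L′,…,L′,L′−U₁′,U₁′,…,U₁′) = (A′,L′,…,L′) — "Thus, we arrive at the sum of terms (17) (−1)^{n−1}(A′Γ₁)(L′Γ₂)…(L′Γ_n)"
(the common sign (−1)^{n−1} factors out). Slots 2 … n of the paper are indexed 0 … m−1 here (m = n − 1).
[cite: Volkov2024PRD109, §IV C step 7, displays (16)–(17) (arXiv v4 p.18–19; tex l.700–743)] -/
theorem eqTermAfter_sum_eq_eqTermFinal (a : R) (u l : ℕ → R) (m : ℕ) :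
    a * (∏ i ∈ range m, u i) + ∑ k ∈ range m, a * ((∏ i ∈ range k, l i) * (l k - u k) * (∏ i ∈ Ico (k + 1) m, u i)) =
      a * ∏ i ∈ range m, l i := by
  rw [← Finset.mul_sum, ← mul_add, aNode_telescope]

end ANode

end Literature.MathematicalPhysics.QuantumFieldTheory.Volkov2024PRD109
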